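import Summits.NavierStokesRegularity.NavierStokesRegularity.Theorems.EfficiencyFloorProductionEfficiencyDecayTypeIRecurrenceTools
import Summits.NavierStokesRegularity.NavierStokesRegularity.Theorems.EfficiencyFloorEnstrophyBudget
import Summits.NavierStokesRegularity.NavierStokesRegularity.Theorems.EfficiencyFloorBlowupEnstrophyUnbounded
import Summits.NavierStokesRegularity.NavierStokesRegularity.Theorems.EfficiencyFloorProductionEfficiencyDecayEfficiencyConcentration
import Summits.NavierStokesRegularity.NavierStokesRegularity.Theorems.EfficiencyFloorProductionEfficiencyDecayIntegrateEfficiency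
import Summits.NavierStokesRegularity.NavierStokesRegularity.Theses.EfficiencyFloor
import HarnessLib

/-!
# Type-I recurrence of concentrated near-extremal states (line `efficiency_floor`, crux
# `EfficiencyFloor.ProductionEfficiencyDecay`, stmt-NavierStokesRegularity-22866; `--supports`)

The registered skeleton of the crux (Cruxes/ProductionEfficiencyDecay/Lines/efficiency_floor.lean) has its
budget stub S1 (`EnstrophyBudget`, stmt-22995), its integration stub S3 and its structural stub S5
(`EfficiencyConcentration`, stmt-23111) LANDED, and its crux-proper stub S2 (`stub_depletionGivenBudget`:
the Lu–Doering efficiency `Ż/Z³` tends to `0` POINTWISE at blow-up) open. S5 was so far unused by any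
theorem about the flow. This file is the first DYNAMIC use of S5: it composes S1 + S5 + blow-up of the
enstrophy (stmt-22867) + the mean value theorem into a structure theorem about hypothetical LERAY-RATE
(enstrophy-Type-I) blow-ups — the objects the crux must exclude.

**`TypeIRecurrence.recurrence`.** Along a maximal smooth Leray–Hopf rapidly-decaying-datum solution on
`[0,T)`, if `Z(t) = ∫|curl u(t)|² ≤ W/√(T−t)` at times `t ↑ T` (liminf-Type-I; e.g. under the quarter law
`EnstrophyQuarterLaw`, stmt-1574), then at times `ξ ↑ T` the enstrophy GROWS at the cubic rate:
`Z(ξ)³/(4W²) ≤ Ż(ξ) = 2S(ξ) − 2ν·Pal(ξ)`. (MVT for `g = Z⁻²` on `[t,T']`, `T'` a later time where `Z` has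
doubled: `g' = −2Ż/Z³` takes the value `≤ −g(t)/(2(T−t)) ≤ −1/(2W²)`.)

**`TypeIRecurrence.recurrence_window`.** At those instants the state is NEAR-EXTREMAL for the Lu–Doering
envelope `|S| ≤ cZ^{3/4}Pal^{3/4}` (tools file, `window`): `ν·Pal ≤ S`, `ν⁴Pal ≤ c⁴Z³`,
`Z³ ≤ (8cW²)^{4/3}·Pal` (palinstrophy ratio `ν⁴Pal/Z³` in a fixed compact window of `(0, c⁴]`), and the
stretching is `ε₁`-EFFICIENT, `S ≥ ε₁ Z^{3/4}Pal^{3/4}`, `ε₁ = ν³/(8c³W²)`.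

**`TypeIRecurrence.main`.** Hence (S5 at `ε₁`, radius `K√(Z/Pal) ≤ K(8cW²)^{2/3}/Z`): for every `ν, W > 0`
there are `δ₀, R₀ > 0` such that every such solution has, at times `ξ ↑ T`, a `δ₀`-FRACTION OF ITS
ENSTROPHY IN ONE BALL OF RADIUS `R₀/Z(ξ) → 0`. `of_quarterLaw` / `of_enstrophyQuarterLaw` specialise to the
quarter law (for one solution / as the route's residual item).

READ-OUT FOR THE LINE. (i) A Leray-rate blow-up cannot avoid the concentrated near-extremal states: it
must RECUR to them all the way to `T`; the open stub S2 (equivalently the crux, `…Reduction.lean`) is therefore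
exactly a NO-RETURN / EXIT statement for these states — the 'dynamical exit estimate for ε-efficient
concentrated configurations' named by the lead and the planner, now with its input typed and proved.
(ii) What the route's deciding theorem consumes of the crux is only the floor `Z√(T−t) → ∞`, i.e. the
failure of the hypothesis of `main` for every `W`; the pointwise form of S2 is stronger than needed — the
minimal crux is the Cesàro-mean form `(T−t)⁻¹ ∫_t^T Ż/Z³ → 0` (density of growth instants → 0).

HONEST FRAMING: structure theorems about a HYPOTHETICAL maximal solution of finite lifespan; nothing here
asserts that one exists; the crux `ProductionEfficiencyDecay` is NOT proved (it stays open-problem grade);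
NS regularity is NOT proved by anything in this file; no summit is claimed. [folklore]
-/

-- the problem directory repeats the summit name (`NavierStokesRegularity/NavierStokesRegularity`)
set_option linter.dupNamespace false

noncomputable section

open Set Filter MeasureTheory Topology
open scoped InnerProductSpace ENNReal NNReal
open Literature.Analysis.FluidPDE

namespace Summit.NavierStokesRegularity.NavierStokesRegularity.Theorems

namespace TypeIRecurrence

/-! ## 3. Along a maximal smooth Leray–Hopf solution: recurrence of growth instants -/

variable {ν T : ℝ} {u : ℝ → EuclideanSpace ℝ (Fin 3) → EuclideanSpace ℝ (Fin 3)}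
  {p : ℝ → EuclideanSpace ℝ (Fin 3) → ℝ}

/-- Eventually (as `t ↑ T`) the real enstrophy `Zr` of the budget dominates any level `N` (blow-up forces
`Z → ∞`, stmt-22867), at times in `(0,T)`. [folklore] -/
theorem eventually_le_Zr (hν : 0 < ν) (hT : 0 < T) (hmax : IsMaximalSmoothSolution ν 0 u p T)
    (hLH : IsLerayHopfOn T ν 0 (u 0) u) (hdec : HasRapidSpatialDecay (u 0)) {Zr : ℝ → ℝ}
    (hZeq : ∀ t ∈ Ioo 0 T, ∫⁻ x, ‖curl (u t) x‖ₑ ^ 2 = ENNReal.ofReal (Zr t))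
    (hZ0 : ∀ t ∈ Ioo 0 T, 0 ≤ Zr t) (N : ℝ) :
    ∀ᶠ t in 𝓝[<] T, t ∈ Ioo 0 T ∧ N ≤ Zr t := by
  filter_upwards [BlowupEnstrophyUnbounded.main hν hT hmax hLH hdec N, Ioo_mem_nhdsLT hT]
    with t hN ht
  refine ⟨ht, ?_⟩
  rw [hZeq t ht] at hN
  exact (ENNReal.ofReal_le_ofReal_iff (hZ0 t ht)).1 hN

/-- **Recurrence of growth instants under a liminf-Type-I enstrophy bound.** Along a maximal smooth
Leray–Hopf rapidly-decaying-datum solution with enstrophy `Z` (`HasDerivAt Z (2S − 2νPal)` on `(0,T)`):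
if `Z(t) ≤ W/√(T−t)` at times `t` arbitrarily close to `T` (e.g. under the quarter law, stmt-1574), then
at times `ξ` arbitrarily close to `T` the enstrophy GROWS at the Lu–Doering cubic rate,
`Z(ξ)³/(4W²) ≤ Ż(ξ) = 2S(ξ) − 2ν·Pal(ξ)` (mean value theorem for `Z⁻²` between such a `t` and a later
time at which `Z` has doubled, which exists by stmt-22867). [folklore] -/
theorem recurrence (hν : 0 < ν) (hT : 0 < T) (hmax : IsMaximalSmoothSolution ν 0 u p T)
    (hLH : IsLerayHopfOn T ν 0 (u 0) u) (hdec : HasRapidSpatialDecay (u 0)) {Zr Pr Sr : ℝ → ℝ}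
    (hZeq : ∀ t ∈ Ioo 0 T, ∫⁻ x, ‖curl (u t) x‖ₑ ^ 2 = ENNReal.ofReal (Zr t))
    (hZ0 : ∀ t ∈ Ioo 0 T, 0 ≤ Zr t)
    (hD : ∀ t ∈ Ioo 0 T, HasDerivAt Zr (2 * Sr t - 2 * ν * Pr t) t) {W : ℝ} (hW : 0 < W)
    (hfreq : ∃ᶠ t in 𝓝[<] T,
      ∫⁻ x, ‖curl (u t) x‖ₑ ^ 2 ≤ ENNReal.ofReal (W / Real.sqrt (T - t))) :
    ∃ᶠ t in 𝓝[<] T, t ∈ Ioo 0 T ∧ 0 < Zr t ∧ Zr t ^ 3 / (4 * W ^ 2) ≤ 2 * Sr t - 2 * ν * Pr t := by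
  rw [Filter.frequently_iff]
  intro U hU
  obtain ⟨a, haT, haU⟩ := mem_nhdsLT_iff_exists_Ioo_subset.1 hU
  -- a late window on which `Z ≥ 1`
  obtain ⟨t₁, ht₁T, ht₁⟩ :=
    mem_nhdsLT_iff_exists_Ioo_subset.1 (eventually_le_Zr hν hT hmax hLH hdec hZeq hZ0 1)
  -- a time `t` in the window with `Z(t) ≤ W/√(T−t)`
  obtain ⟨t, hbound, ht⟩ := (hfreq.and_eventually (Ioo_mem_nhdsLT (max_lt haT ht₁T))).exists
  have hat : a < t := (le_max_left _ _).trans_lt ht.1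
  have ht₁t : t₁ < t := (le_max_right _ _).trans_lt ht.1
  have htT : t < T := ht.2
  have hwin : ∀ s ∈ Ico t T, s ∈ Ioo 0 T ∧ 1 ≤ Zr s := fun s hs => ht₁ ⟨ht₁t.trans_le hs.1, hs.2⟩
  have htI : t ∈ Ioo 0 T := (hwin t ⟨le_rfl, htT⟩).1
  have hZt : 0 < Zr t := one_pos.trans_le (hwin t ⟨le_rfl, htT⟩).2
  -- `g = Z⁻²` and its derivative on `[t,T)`
  set g : ℝ → ℝ := fun s => (Zr s)⁻¹ ^ 2 with hg
  set g' : ℝ → ℝ := fun s => -2 * (2 * Sr s - 2 * ν * Pr s) / Zr s ^ 3 with hg'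
  have hder : ∀ s ∈ Ico t T, HasDerivAt g (g' s) s := fun s hs =>
    ProductionEfficiencyDecay.hasDerivAt_inv_sq (hD s (hwin s hs).1)
      (one_pos.trans_le (hwin s hs).2).ne'
  have hgt : 0 < g t := by simp only [hg]; positivity
  -- a later time where `Z` has doubled: `g ≤ g(t)/4` there
  have hlow : ∃ T' ∈ Ioo t T, g T' ≤ g t / 4 := by
    obtain ⟨T', ⟨-, hN⟩, hT'⟩ :=
      ((eventually_le_Zr hν hT hmax hLH hdec hZeq hZ0 (2 * Zr t)).and (Ioo_mem_nhdsLT htT)).exists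
    refine ⟨T', hT', ?_⟩
    have h2 : 0 < 2 * Zr t := by positivity
    have h3 : (Zr T')⁻¹ ≤ (2 * Zr t)⁻¹ := inv_anti₀ h2 hN
    have h4 : (Zr T')⁻¹ ^ 2 ≤ (2 * Zr t)⁻¹ ^ 2 :=
      pow_le_pow_left₀ (inv_nonneg.2 (h2.le.trans hN)) h3 2
    have h5 : (2 * Zr t)⁻¹ ^ 2 = (Zr t)⁻¹ ^ 2 / 4 := by
      rw [mul_inv, mul_pow]; norm_num; ring
    simp only [hg]
    linarith [h4, h5]
  obtain ⟨ξ, hξ, hgξ⟩ := exists_deriv_le hder hgt hlow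
  -- `g(t) ≥ (T−t)/W²`
  have hTt : 0 < T - t := sub_pos.2 htT
  have hZle : Zr t ≤ W / Real.sqrt (T - t) := by
    have h := hbound
    rw [hZeq t htI] at h
    exact (ENNReal.ofReal_le_ofReal_iff (by positivity)).1 h
  have hW2 : 0 < W ^ 2 := pow_pos hW 2
  have hgt' : (T - t) / W ^ 2 ≤ g t := by
    have h1 : Zr t ^ 2 ≤ W ^ 2 / (T - t) := by
      calc Zr t ^ 2 ≤ (W / Real.sqrt (T - t)) ^ 2 := pow_le_pow_left₀ hZt.le hZle 2
        _ = W ^ 2 / (T - t) := by rw [div_pow, Real.sq_sqrt hTt.le]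
    have h2 : (W ^ 2 / (T - t))⁻¹ ≤ (Zr t ^ 2)⁻¹ := inv_anti₀ (pow_pos hZt 2) h1
    rw [inv_div] at h2
    simpa only [hg, inv_pow] using h2
  -- hence `g'(ξ) ≤ −1/(2W²)`, i.e. `Ż(ξ) ≥ Z(ξ)³/(4W²)`
  have hξI : ξ ∈ Ioo 0 T := (hwin ξ ⟨hξ.1.le, hξ.2⟩).1
  have hZξ : 0 < Zr ξ := one_pos.trans_le (hwin ξ ⟨hξ.1.le, hξ.2⟩).2
  have hZ3 : 0 < Zr ξ ^ 3 := pow_pos hZξ 3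
  have h1 : 1 / (2 * W ^ 2) ≤ g t / (2 * (T - t)) := by
    rw [div_le_div_iff₀ (by positivity) (by positivity)]
    have h0 : T - t ≤ g t * W ^ 2 := (div_le_iff₀ hW2).1 hgt'
    linarith
  refine ⟨ξ, haU ⟨hat.trans hξ.1, hξ.2⟩, hξI, hZξ, ?_⟩
  have h3 : 1 / (2 * W ^ 2) ≤ 2 * (2 * Sr ξ - 2 * ν * Pr ξ) / Zr ξ ^ 3 := by
    have : g' ξ = -(2 * (2 * Sr ξ - 2 * ν * Pr ξ) / Zr ξ ^ 3) := by
      simp only [hg']; ring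
    linarith [hgξ, h1]
  rw [le_div_iff₀ hZ3] at h3
  rw [div_le_iff₀ (by positivity : (0:ℝ) < 4 * W ^ 2)]
  have h4 : 1 / (2 * W ^ 2) * Zr ξ ^ 3 * (4 * W ^ 2) = 2 * Zr ξ ^ 3 := by field_simp; ring
  nlinarith [h3, h4, hZ3, hW2]

/-- The growth instants of `recurrence` are concentrated near-extremal states: the palinstrophy is pinned to
the Lu–Doering window `Z³ ≤ (8cW²)^{4/3}·Pal`, `ν⁴·Pal ≤ c⁴Z³`, and the stretching is `ε₁`-efficient,
`ε₁ = ν³/(8c³W²)`. [folklore] -/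
theorem recurrence_window (hν : 0 < ν) (hT : 0 < T) (hmax : IsMaximalSmoothSolution ν 0 u p T)
    (hLH : IsLerayHopfOn T ν 0 (u 0) u) (hdec : HasRapidSpatialDecay (u 0)) {c : ℝ} (hc : 0 < c)
    {Zr Pr Sr : ℝ → ℝ}
    (hZ : ∀ t ∈ Set.Ioo 0 T,
      ∫⁻ x, ‖curl (u t) x‖ₑ ^ 2 = ENNReal.ofReal (Zr t) ∧ 0 ≤ Zr t ∧ 0 ≤ Pr t ∧
      Pr t = ∫ x, frobeniusNormSq (fderiv ℝ (curl (u t)) x) ∧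
      Sr t = ∫ x, ⟪curl (u t) x, fderiv ℝ (u t) x (curl (u t) x)⟫_ℝ ∧
      HasDerivAt Zr (2 * Sr t - 2 * ν * Pr t) t ∧
      |Sr t| ≤ c * Zr t ^ (3 / 4 : ℝ) * Pr t ^ (3 / 4 : ℝ))
    {W : ℝ} (hW : 0 < W)
    (hfreq : ∃ᶠ t in 𝓝[<] T,
      ∫⁻ x, ‖curl (u t) x‖ₑ ^ 2 ≤ ENNReal.ofReal (W / Real.sqrt (T - t))) :
    ∃ᶠ t in 𝓝[<] T, t ∈ Ioo 0 T ∧ 0 < Zr t ∧ 0 < Pr t ∧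
      Zr t ^ 3 / (4 * W ^ 2) ≤ 2 * Sr t - 2 * ν * Pr t ∧ ν * Pr t ≤ Sr t ∧
      ν ^ 4 * Pr t ≤ c ^ 4 * Zr t ^ 3 ∧ Zr t ^ 3 ≤ (2 * c / (1 / (4 * W ^ 2))) ^ (4 / 3 : ℝ) * Pr t ∧
      1 / (4 * W ^ 2) * ν ^ 3 / (2 * c ^ 3) * Zr t ^ (3 / 4 : ℝ) * Pr t ^ (3 / 4 : ℝ) ≤ Sr t := by
  have hrec := recurrence hν hT hmax hLH hdec (fun t ht => (hZ t ht).1) (fun t ht => (hZ t ht).2.1)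
    (fun t ht => (hZ t ht).2.2.2.2.2.1) hW hfreq
  refine hrec.mono ?_
  rintro ξ ⟨hξI, hZξ, hgrow⟩
  obtain ⟨-, -, hP0, -, -, -, henv⟩ := hZ ξ hξI
  have hε₀ : (0:ℝ) < 1 / (4 * W ^ 2) := by positivity
  have hgrow' : 1 / (4 * W ^ 2) * Zr ξ ^ 3 ≤ 2 * Sr ξ - 2 * ν * Pr ξ := by
    have : 1 / (4 * W ^ 2) * Zr ξ ^ 3 = Zr ξ ^ 3 / (4 * W ^ 2) := by ring
    rw [this]; exact hgrow
  obtain ⟨hPpos, hS1, hνc, hwin, heff⟩ := window hc hν hε₀ hZξ hP0 henv hgrow'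
  exact ⟨hξI, hZξ, hPpos, hgrow, hS1, hνc, hwin, heff⟩

/-! ## 4. Concentration: the structural lemma S5 (stmt-23111) at the growth instants -/

/-- **A growth instant is a concentrated state.** At a time `ξ ∈ (0,T)` of `ε₀`-growth
(`ε₀ Z³ ≤ 2S − 2ν·Pal`) of a maximal smooth Leray–Hopf rapidly-decaying-datum solution, the window algebra
makes the stretching `ε₁`-efficient (`ε₁ = ε₀ν³/(2c³)`), so the structural lemma S5 (stmt-23111, constants
`K, δ` at `ε₁`, taken as a hypothesis so that they can be fixed before the solution) puts a `δ`-fraction of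
the enstrophy in one ball of radius `K√((2c/ε₀)^{4/3})/Z(ξ)`. [folklore] -/
theorem concentrated_of_growth (hν : 0 < ν) (hT : 0 < T) (hmax : IsMaximalSmoothSolution ν 0 u p T)
    (hLH : IsLerayHopfOn T ν 0 (u 0) u) (hdec : HasRapidSpatialDecay (u 0)) {c ε₀ K δ : ℝ}
    (hc : 0 < c) (hε₀ : 0 < ε₀) (hK : 0 < K)
    (hS5 : ∀ v : EuclideanSpace ℝ (Fin 3) → EuclideanSpace ℝ (Fin 3), ContDiff ℝ (⊤ : ℕ∞) v →
      Literature.Analysis.FluidPDE.VectorCalculus.IsDivFree v → (∫⁻ x, ‖iteratedFDeriv ℝ 0 v x‖ₑ ^ 2 < ⊤) →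
      (∫⁻ x, ‖iteratedFDeriv ℝ 1 v x‖ₑ ^ 2 < ⊤) → (∫⁻ x, ‖iteratedFDeriv ℝ 2 v x‖ₑ ^ 2 < ⊤) →
      0 < ∫ x, ‖curl v x‖ ^ 2 → 0 < ∫ x, frobeniusNormSq (fderiv ℝ (curl v) x) →
      ε₀ * ν ^ 3 / (2 * c ^ 3) * (∫ x, ‖curl v x‖ ^ 2) ^ (3 / 4 : ℝ) *
          (∫ x, frobeniusNormSq (fderiv ℝ (curl v) x)) ^ (3 / 4 : ℝ) ≤
        ∫ x, ⟪curl v x, fderiv ℝ v x (curl v x)⟫_ℝ →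
      ∃ a : EuclideanSpace ℝ (Fin 3), δ * ∫ x, ‖curl v x‖ ^ 2 ≤
        ∫ x in Metric.ball a (K * Real.sqrt ((∫ x, ‖curl v x‖ ^ 2) /
          ∫ x, frobeniusNormSq (fderiv ℝ (curl v) x))), ‖curl v x‖ ^ 2)
    {ξ : ℝ} (hξI : ξ ∈ Ioo 0 T) {Z P S : ℝ}
    (hZeq : ∫⁻ x, ‖curl (u ξ) x‖ₑ ^ 2 = ENNReal.ofReal Z) (hZpos : 0 < Z) (hP0 : 0 ≤ P)
    (hPeq : P = ∫ x, frobeniusNormSq (fderiv ℝ (curl (u ξ)) x))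
    (hSeq : S = ∫ x, ⟪curl (u ξ) x, fderiv ℝ (u ξ) x (curl (u ξ) x)⟫_ℝ)
    (henv : |S| ≤ c * Z ^ (3 / 4 : ℝ) * P ^ (3 / 4 : ℝ)) (hgrow : ε₀ * Z ^ 3 ≤ 2 * S - 2 * ν * P) :
    0 < ∫ x, ‖curl (u ξ) x‖ ^ 2 ∧
      ∃ a : EuclideanSpace ℝ (Fin 3), δ * ∫ x, ‖curl (u ξ) x‖ ^ 2 ≤
        ∫ x in Metric.ball a (K * Real.sqrt ((2 * c / ε₀) ^ (4 / 3 : ℝ)) / ∫ x, ‖curl (u ξ) x‖ ^ 2),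
          ‖curl (u ξ) x‖ ^ 2 := by
  obtain ⟨hPpos, -, -, hwin, heff⟩ := window hc hν hε₀ hZpos hP0 henv hgrow
  have hApos : 0 < (2 * c / ε₀) ^ (4 / 3 : ℝ) := Real.rpow_pos_of_pos (by positivity) _
  -- regularity of the slice `u ξ`
  have hξ' : ξ ∈ Ico 0 T := ⟨hξI.1.le, hξI.2⟩
  have hsol := hmax.isClassicalNSSolutionOn
  have hsm : ContDiff ℝ (⊤ : ℕ∞) (u ξ) := hsol.contDiff_velocity hξ'
  have hn : ∀ n : ℕ, ∫⁻ x, ‖iteratedFDeriv ℝ n (u ξ) x‖ₑ ^ 2 < ⊤ := fun n =>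
    EnstrophyBudget.sobolev_slice (EnstrophyBudget.isLocalSolution hν hT hsol hLH hdec) hξ' n
  -- `Z` is the real enstrophy of the slice
  have hZi : Z = ∫ x, ‖curl (u ξ) x‖ ^ 2 := by
    have h := hZeq
    rw [lintegral_enorm_curl_sq_eq_ofReal_integral (hsm.of_le (by norm_cast)) (hn 1)] at h
    exact ((ENNReal.ofReal_eq_ofReal_iff (integral_nonneg fun x => by positivity) hZpos.le).1 h).symm
  rw [hZi] at hZpos hwin heff
  rw [hPeq] at hPpos hwin heff
  rw [hSeq] at heff
  obtain ⟨a, ha⟩ := hS5 (u ξ) hsm (hsol.divFree ξ hξ') (hn 0) (hn 1) (hn 2) hZpos hPpos heff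
  refine ⟨hZpos, a, ha.trans ?_⟩
  -- enlarge the ball: radius `K√(Z/Pal) ≤ K√A / Z`
  have hr := radius_le hApos.le hK.le hZpos hPpos hwin
  refine setIntegral_mono_set ?_ ?_ (Metric.ball_subset_ball hr).eventuallyLE
  · exact (integrable_norm_curl_sq (hsm.of_le (by norm_cast)) (hn 1)).1.integrableOn
  · exact ae_of_all _ fun x => by positivity

/-- **Type-I recurrence of concentrated near-extremal states.** For every `ν, W > 0` there are
`δ₀, R₀ > 0` (depending only on `ν`, `W`, the universal envelope constant of stmt-22995 and the
concentration constants of stmt-23111) such that along every maximal smooth Leray–Hopf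
rapidly-decaying-datum solution on `[0,T)` whose enstrophy obeys `Z(t) ≤ W/√(T−t)` at times arbitrarily
close to `T` (liminf-Type-I in enstrophy; e.g. any blow-up obeying the quarter law, stmt-1574), there are
times `ξ` arbitrarily close to `T` at which a `δ₀`-fraction of the enstrophy `Z(ξ) = ∫|curl u(ξ)|²` sits in
ONE ball of radius `R₀/Z(ξ)` (which tends to `0`, since `Z → ∞`). A structure statement about a
HYPOTHETICAL blow-up; nothing about NS regularity is asserted, and the crux `ProductionEfficiencyDecay` is
NOT proved. [folklore] -/
theorem main : ∀ (ν W : ℝ), 0 < ν → 0 < W → ∃ δ₀ R₀ : ℝ, 0 < δ₀ ∧ 0 < R₀ ∧ ∀ (T : ℝ), 0 < T →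
    ∀ (u : ℝ → EuclideanSpace ℝ (Fin 3) → EuclideanSpace ℝ (Fin 3))
      (p : ℝ → EuclideanSpace ℝ (Fin 3) → ℝ),
      IsMaximalSmoothSolution ν 0 u p T → IsLerayHopfOn T ν 0 (u 0) u → HasRapidSpatialDecay (u 0) →
      (∃ᶠ t in 𝓝[<] T, ∫⁻ x, ‖curl (u t) x‖ₑ ^ 2 ≤ ENNReal.ofReal (W / Real.sqrt (T - t))) →
      ∃ᶠ t in 𝓝[<] T, 0 < ∫ x, ‖curl (u t) x‖ ^ 2 ∧
        ∃ a : EuclideanSpace ℝ (Fin 3), δ₀ * ∫ x, ‖curl (u t) x‖ ^ 2 ≤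
          ∫ x in Metric.ball a (R₀ / ∫ x, ‖curl (u t) x‖ ^ 2), ‖curl (u t) x‖ ^ 2 := by
  obtain ⟨c, hc, hB⟩ := EnstrophyBudget.main
  intro ν W hν hW
  obtain ⟨ε₀, hε₀⟩ : ∃ ε₀ : ℝ, ε₀ = 1 / (4 * W ^ 2) := ⟨_, rfl⟩
  have hε₀pos : 0 < ε₀ := by rw [hε₀]; positivity
  obtain ⟨K, δ, hK, hδ, hS5⟩ :=
    ProductionEfficiencyDecay.stub_efficiencyConcentration (ε₀ * ν ^ 3 / (2 * c ^ 3)) (by positivity)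
  have hApos : 0 < (2 * c / ε₀) ^ (4 / 3 : ℝ) := Real.rpow_pos_of_pos (by positivity) _
  refine ⟨δ, K * Real.sqrt ((2 * c / ε₀) ^ (4 / 3 : ℝ)), hδ, mul_pos hK (Real.sqrt_pos.2 hApos), ?_⟩
  intro T hT u p hmax hLH hdec hfreq
  obtain ⟨Zr, Pr, Sr, hZ⟩ := hB ν T hν hT u p hmax hLH hdec
  have hrec := recurrence hν hT hmax hLH hdec (fun t ht => (hZ t ht).1) (fun t ht => (hZ t ht).2.1)
    (fun t ht => (hZ t ht).2.2.2.2.2.1) hW hfreq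
  refine hrec.mono ?_
  rintro ξ ⟨hξI, hZξ, hgrow⟩
  obtain ⟨hZeq, -, hP0, hPeq, hSeq, -, henv⟩ := hZ ξ hξI
  have hgrow' : ε₀ * Zr ξ ^ 3 ≤ 2 * Sr ξ - 2 * ν * Pr ξ := by
    have : ε₀ * Zr ξ ^ 3 = Zr ξ ^ 3 / (4 * W ^ 2) := by rw [hε₀]; ring
    rw [this]; exact hgrow
  exact concentrated_of_growth hν hT hmax hLH hdec hc hε₀pos hK hS5 hξI hZeq hZξ hP0 hPeq hSeq henv
    hgrow'

/-- **Under the quarter law** (the conclusion of the route's residual `EnstrophyQuarterLaw`, stmt-1574, for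
THIS solution): a maximal smooth Leray–Hopf rapidly-decaying-datum solution with `Z(t) ≤ K/√(T−t)` on
`[0,T)` recurs to concentrated states — with the constants `δ₀, R₀` of `main` at `W = max K 1`, at
times arbitrarily close to `T` a `δ₀`-fraction of the enstrophy sits in one ball of radius `R₀/Z`.
Nothing about NS regularity is asserted. [folklore] -/
theorem of_quarterLaw {ν K : ℝ} (hν : 0 < ν) :
    ∃ δ₀ R₀ : ℝ, 0 < δ₀ ∧ 0 < R₀ ∧ ∀ (T : ℝ), 0 < T →
    ∀ (u : ℝ → EuclideanSpace ℝ (Fin 3) → EuclideanSpace ℝ (Fin 3))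
      (p : ℝ → EuclideanSpace ℝ (Fin 3) → ℝ),
      IsMaximalSmoothSolution ν 0 u p T → IsLerayHopfOn T ν 0 (u 0) u → HasRapidSpatialDecay (u 0) →
      (∀ t ∈ Ico 0 T, ∫⁻ x, ‖curl (u t) x‖ₑ ^ 2 ≤ ENNReal.ofReal (K / Real.sqrt (T - t))) →
      ∃ᶠ t in 𝓝[<] T, 0 < ∫ x, ‖curl (u t) x‖ ^ 2 ∧
        ∃ a : EuclideanSpace ℝ (Fin 3), δ₀ * ∫ x, ‖curl (u t) x‖ ^ 2 ≤
          ∫ x in Metric.ball a (R₀ / ∫ x, ‖curl (u t) x‖ ^ 2), ‖curl (u t) x‖ ^ 2 := by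
  obtain ⟨δ₀, R₀, hδ₀, hR₀, h⟩ := main ν (max K 1) hν (lt_max_of_lt_right one_pos)
  refine ⟨δ₀, R₀, hδ₀, hR₀, fun T hT u p hmax hLH hdec hq => h T hT u p hmax hLH hdec ?_⟩
  have hev : ∀ᶠ t in 𝓝[<] T, ∫⁻ x, ‖curl (u t) x‖ₑ ^ 2 ≤
      ENNReal.ofReal (max K 1 / Real.sqrt (T - t)) := by
    filter_upwards [Ico_mem_nhdsLT hT] with t ht
    refine (hq t ht).trans (ENNReal.ofReal_le_ofReal ?_)
    exact div_le_div_of_nonneg_right (le_max_left _ _) (Real.sqrt_nonneg _)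
  exact hev.frequently

/-- **Under the route's residual item `EnstrophyQuarterLaw` (stmt-1574)**: every maximal smooth Leray–Hopf
rapidly-decaying-datum solution of finite lifespan would recur, at times arbitrarily close to its blow-up
time, to states with a fixed fraction of the enstrophy in one ball of radius `O(1/Z)`. A conditional
structure statement (the residual is open); nothing about NS regularity is asserted. [folklore] -/
theorem of_enstrophyQuarterLaw
    (hQ : Summit.NavierStokesRegularity.NavierStokesRegularity.Theses.EfficiencyFloor.EnstrophyQuarterLaw)
    {ν T : ℝ} (hν : 0 < ν) (hT : 0 < T)
    {u : ℝ → EuclideanSpace ℝ (Fin 3) → EuclideanSpace ℝ (Fin 3)} {p : ℝ → EuclideanSpace ℝ (Fin 3) → ℝ}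
    (hmax : IsMaximalSmoothSolution ν 0 u p T) (hLH : IsLerayHopfOn T ν 0 (u 0) u)
    (hdec : HasRapidSpatialDecay (u 0)) :
    ∃ δ₀ R₀ : ℝ, 0 < δ₀ ∧ 0 < R₀ ∧
      ∃ᶠ t in 𝓝[<] T, 0 < ∫ x, ‖curl (u t) x‖ ^ 2 ∧
        ∃ a : EuclideanSpace ℝ (Fin 3), δ₀ * ∫ x, ‖curl (u t) x‖ ^ 2 ≤
          ∫ x in Metric.ball a (R₀ / ∫ x, ‖curl (u t) x‖ ^ 2), ‖curl (u t) x‖ ^ 2 := by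
  obtain ⟨K, hK⟩ := hQ ν T hν hT u p hmax hLH hdec
  obtain ⟨δ₀, R₀, hδ₀, hR₀, h⟩ := of_quarterLaw (K := K) hν
  exact ⟨δ₀, R₀, hδ₀, hR₀, h T hT u p hmax hLH hdec hK⟩

end TypeIRecurrence

end Summit.NavierStokesRegularity.NavierStokesRegularity.Theorems

end
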